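import Mathlib.Analysis.Complex.Basic
import Mathlib.Analysis.Normed.Group.InfiniteSum
import Mathlib.Topology.Algebra.InfiniteSum.ENNReal
import HarnessLib

/-!
# Transfer of weighted re-indexing identities from `[0, ∞]`-valued to real and complex sums

Topic `Topology/Algebra/InfiniteSum`; theorems only. A frequent pattern (double counting,
orbit decompositions, unfolding): one proves, for ALL `g : X → [0, ∞]`, an identity of
unconditional sums

  `Σ'_{x} g(x) = Σ'_{q} Σ'_{b} w(b) · g(π(q, b))`                                     `(H)`

(`w : B → ℝ≥0` weights, `π : Q → B → X`), typically by fibre counting where no convergence issue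
arises, and then wants the same identity for an absolutely summable `f : X → ℝ` or `→ ℂ`, together
with the summability of the inner and outer families on the right. This file performs that
transfer once and for all:

* `tsum_eq_tsum_weighted_of_nonneg` — real `f ≥ 0` summable;
* `tsum_eq_tsum_weighted_real` — real `f` with `Summable ‖f‖`;
* `tsum_eq_tsum_weighted_complex` — complex `f` with `Summable ‖f‖`.

[folklore]
-/

noncomputable section

open scoped ENNReal NNReal
open Complex

namespace Literature.Topology.Algebra.InfiniteSum

variable {X Q B : Type*} (π : Q → B → X) (w : B → ℝ≥0)

/-- **Transfer for non-negative summable `f`.** If `(H)` holds for all `[0, ∞]`-valued `g`, then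
for `f ≥ 0` summable: every inner family `b ↦ w(b) f(π(q,b))` is summable, the outer family of
inner sums is summable, and `Σ' f = Σ'_q Σ'_b w f∘π`. [folklore] -/
theorem tsum_eq_tsum_weighted_of_nonneg
    (H : ∀ g : X → ℝ≥0∞, ∑' x, g x = ∑' q, ∑' b, (w b : ℝ≥0∞) * g (π q b))
    (f : X → ℝ) (hf0 : ∀ x, 0 ≤ f x) (hf : Summable f) :
    (∀ q, Summable fun b => (w b : ℝ) * f (π q b)) ∧
      (Summable fun q => ∑' b, (w b : ℝ) * f (π q b)) ∧
        ∑' x, f x = ∑' q, ∑' b, (w b : ℝ) * f (π q b) := by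
  have Hf := H (fun x => ENNReal.ofReal (f x))
  have hL : (∑' x, ENNReal.ofReal (f x)) = ENNReal.ofReal (∑' x, f x) :=
    (ENNReal.ofReal_tsum_of_nonneg hf0 hf).symm
  have hfin : (∑' q, ∑' b, (w b : ℝ≥0∞) * ENNReal.ofReal (f (π q b))) ≠ ∞ := by
    rw [← Hf, hL]; exact ENNReal.ofReal_ne_top
  have hinner : ∀ q, (∑' b, (w b : ℝ≥0∞) * ENNReal.ofReal (f (π q b))) ≠ ∞ := fun q =>
    ne_top_of_le_ne_top hfin (ENNReal.le_tsum q)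
  have hterm : ∀ q b, ((w b : ℝ≥0∞) * ENNReal.ofReal (f (π q b))).toReal = (w b : ℝ) * f (π q b) := by
    intro q b
    rw [ENNReal.toReal_mul, ENNReal.toReal_ofReal (hf0 _), ENNReal.coe_toReal]
  have hsum_inner : ∀ q, Summable fun b => (w b : ℝ) * f (π q b) := by
    intro q
    have := ENNReal.summable_toReal (hinner q)
    simpa only [hterm] using this
  have hval_inner : ∀ q, (∑' b, (w b : ℝ≥0∞) * ENNReal.ofReal (f (π q b))).toReal =
      ∑' b, (w b : ℝ) * f (π q b) := by
    intro q
    rw [ENNReal.tsum_toReal_eq (fun b => ENNReal.mul_ne_top ENNReal.coe_ne_top ENNReal.ofReal_ne_top)]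
    exact tsum_congr (hterm q)
  refine ⟨hsum_inner, ?_, ?_⟩
  · have := ENNReal.summable_toReal hfin
    simpa only [hval_inner] using this
  · have h1 : (∑' x, f x) = (∑' x, ENNReal.ofReal (f x)).toReal := by
      rw [hL, ENNReal.toReal_ofReal (tsum_nonneg hf0)]
    rw [h1, Hf, ENNReal.tsum_toReal_eq hinner]
    exact tsum_congr hval_inner

/-- **Transfer for real absolutely summable `f`** (`f = f⁺ - f⁻`). [folklore] -/
theorem tsum_eq_tsum_weighted_real
    (H : ∀ g : X → ℝ≥0∞, ∑' x, g x = ∑' q, ∑' b, (w b : ℝ≥0∞) * g (π q b))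
    (f : X → ℝ) (hf : Summable fun x => ‖f x‖) :
    (∀ q, Summable fun b => (w b : ℝ) * f (π q b)) ∧
      (Summable fun q => ∑' b, (w b : ℝ) * f (π q b)) ∧
        ∑' x, f x = ∑' q, ∑' b, (w b : ℝ) * f (π q b) := by
  -- positive and negative parts
  set fp : X → ℝ := fun x => max (f x) 0 with hfp
  set fm : X → ℝ := fun x => max (-f x) 0 with hfm
  have hfp0 : ∀ x, 0 ≤ fp x := fun x => le_max_right _ _
  have hfm0 : ∀ x, 0 ≤ fm x := fun x => le_max_right _ _
  have hfp_le : ∀ x, fp x ≤ ‖f x‖ := fun x =>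
    max_le (Real.le_norm_self _) (norm_nonneg _)
  have hfm_le : ∀ x, fm x ≤ ‖f x‖ := fun x =>
    max_le (by rw [← norm_neg]; exact Real.le_norm_self _) (norm_nonneg _)
  have hsp : Summable fp := Summable.of_nonneg_of_le hfp0 hfp_le hf
  have hsm : Summable fm := Summable.of_nonneg_of_le hfm0 hfm_le hf
  have hdec : ∀ x, f x = fp x - fm x := fun x => (max_zero_sub_max_neg_zero_eq_self (f x)).symm
  obtain ⟨hp1, hp2, hp3⟩ := tsum_eq_tsum_weighted_of_nonneg π w H fp hfp0 hsp
  obtain ⟨hm1, hm2, hm3⟩ := tsum_eq_tsum_weighted_of_nonneg π w H fm hfm0 hsm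
  have hin_eq : ∀ q, (fun b => (w b : ℝ) * f (π q b)) =
      fun b => (w b : ℝ) * fp (π q b) - (w b : ℝ) * fm (π q b) := by
    intro q; funext b; rw [hdec, mul_sub]
  have hsum_inner : ∀ q, Summable fun b => (w b : ℝ) * f (π q b) := by
    intro q; rw [hin_eq q]; exact (hp1 q).sub (hm1 q)
  have hval_inner : ∀ q, (∑' b, (w b : ℝ) * f (π q b)) =
      (∑' b, (w b : ℝ) * fp (π q b)) - ∑' b, (w b : ℝ) * fm (π q b) := by
    intro q; rw [hin_eq q]; exact (hp1 q).tsum_sub (hm1 q)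
  refine ⟨hsum_inner, ?_, ?_⟩
  · have : (fun q => ∑' b, (w b : ℝ) * f (π q b)) =
        fun q => (∑' b, (w b : ℝ) * fp (π q b)) - ∑' b, (w b : ℝ) * fm (π q b) := funext hval_inner
    rw [this]; exact hp2.sub hm2
  · rw [tsum_congr hval_inner, hp2.tsum_sub hm2, ← hp3, ← hm3, ← hsp.tsum_sub hsm]
    exact tsum_congr hdec

/-- **Transfer for complex absolutely summable `f`** (real and imaginary parts). [folklore] -/
theorem tsum_eq_tsum_weighted_complex
    (H : ∀ g : X → ℝ≥0∞, ∑' x, g x = ∑' q, ∑' b, (w b : ℝ≥0∞) * g (π q b))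
    (f : X → ℂ) (hf : Summable fun x => ‖f x‖) :
    (∀ q, Summable fun b => ((w b : ℝ) : ℂ) * f (π q b)) ∧
      (Summable fun q => ∑' b, ((w b : ℝ) : ℂ) * f (π q b)) ∧
        ∑' x, f x = ∑' q, ∑' b, ((w b : ℝ) : ℂ) * f (π q b) := by
  have hre : Summable fun x => ‖(f x).re‖ :=
    Summable.of_nonneg_of_le (fun _ => norm_nonneg _) (fun x => by
      simpa [Real.norm_eq_abs] using Complex.abs_re_le_norm (f x)) hf
  have him : Summable fun x => ‖(f x).im‖ :=
    Summable.of_nonneg_of_le (fun _ => norm_nonneg _) (fun x => by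
      simpa [Real.norm_eq_abs] using Complex.abs_im_le_norm (f x)) hf
  obtain ⟨hr1, hr2, hr3⟩ := tsum_eq_tsum_weighted_real π w H (fun x => (f x).re) hre
  obtain ⟨hi1, hi2, hi3⟩ := tsum_eq_tsum_weighted_real π w H (fun x => (f x).im) him
  -- the complex summand in terms of real and imaginary parts
  have hdec : ∀ q b, ((w b : ℝ) : ℂ) * f (π q b) =
      (((w b : ℝ) * (f (π q b)).re : ℝ) : ℂ) + (((w b : ℝ) * (f (π q b)).im : ℝ) : ℂ) * I := by
    intro q b
    conv_lhs => rw [← Complex.re_add_im (f (π q b))]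
    push_cast
    ring
  have hsum_inner : ∀ q, Summable fun b => ((w b : ℝ) : ℂ) * f (π q b) := by
    intro q
    have h1 := (Complex.hasSum_ofReal.2 (hr1 q).hasSum).summable
    have h2 := ((Complex.hasSum_ofReal.2 (hi1 q).hasSum).summable).mul_right I
    simpa only [hdec] using h1.add h2
  have hval_inner : ∀ q, (∑' b, ((w b : ℝ) : ℂ) * f (π q b)) =
      ((∑' b, (w b : ℝ) * (f (π q b)).re : ℝ) : ℂ) +
        ((∑' b, (w b : ℝ) * (f (π q b)).im : ℝ) : ℂ) * I := by
    intro q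
    have h1 := (Complex.hasSum_ofReal.2 (hr1 q).hasSum)
    have h2 := ((Complex.hasSum_ofReal.2 (hi1 q).hasSum)).mul_right I
    have := h1.add h2
    simp only [← hdec] at this
    exact this.tsum_eq
  refine ⟨hsum_inner, ?_, ?_⟩
  · have h1 := (Complex.hasSum_ofReal.2 hr2.hasSum).summable
    have h2 := ((Complex.hasSum_ofReal.2 hi2.hasSum).summable).mul_right I
    have := h1.add h2
    refine this.congr fun q => ?_
    rw [hval_inner q]
  · have hf' : Summable f := Summable.of_norm hf
    have hL : (∑' x, f x) = ((∑' x, (f x).re : ℝ) : ℂ) + ((∑' x, (f x).im : ℝ) : ℂ) * I := by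
      rw [← Complex.re_tsum hf', ← Complex.im_tsum hf', Complex.re_add_im]
    have hR : (∑' q, ∑' b, ((w b : ℝ) : ℂ) * f (π q b)) =
        ((∑' q, ∑' b, (w b : ℝ) * (f (π q b)).re : ℝ) : ℂ) +
          ((∑' q, ∑' b, (w b : ℝ) * (f (π q b)).im : ℝ) : ℂ) * I := by
      rw [tsum_congr hval_inner]
      have h1 := Complex.hasSum_ofReal.2 hr2.hasSum
      have h2 := (Complex.hasSum_ofReal.2 hi2.hasSum).mul_right I
      exact (h1.add h2).tsum_eq
    rw [hL, hR, hr3, hi3]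

end Literature.Topology.Algebra.InfiniteSum
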